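import Summits.BirchSwinnertonDyer.BirchSwinnertonDyer.Theorems.PrintCf2SplitBadTwoEtaleBrickGeneration
import Summits.BirchSwinnertonDyer.BirchSwinnertonDyer.Theorems.PrintCf2SplitBadTwoCMPrimaryLocalTypesNamed
import Summits.BirchSwinnertonDyer.BirchSwinnertonDyer.Theorems.PrintCf2SplitBadTwoCMPrimaryModule
import Summits.BirchSwinnertonDyer.BirchSwinnertonDyer.Theorems.PrintCf2SplitBadTwoScalarSubOneSurjective
import Literature.NumberTheory.EllipticCurves.TateModuleTwistTransportProofs
import HarnessLib

/-!
# Crux `PrintCf2.SplitBadTwoRankOneOfFacts` (stmt-BirchSwinnertonDyer-20368), road α v12, the étale brick (ET):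
# THE TWO GALOIS INPUTS OF THE ASSEMBLY — `I_L` FIXES `W*`, AND A FROBENIUS IN `Γ_L` HAS `F − 1` ONTO `W*`

Cell `bsd-print-cf2`, EXTRA WIDTH seat `bsd-line-cf2-p1-w4` g10 (prover-bsd-line-cf2-p1-w4-g10-0); `--supports stmt-BirchSwinnertonDyer-20368`
(helper, Theses-free). HONEST FRAMING: nothing here closes the crux or a registered stub; BSD is not proved by any of this; no summit
`Statement.lean` is touched; no `sorry`, no new axiom, no Literature fact, no definition.

## What is proved

`EtaleGeneration.two_nsmul_resOfLe_proj_kummer_eq_zero_of_inputs` (this seat, p687144) reduces the étale brick (ET-𝔭) at a dyadic place `𝔭`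
to three arithmetic inputs about `S = Γ_L`, `L = K(√d)`: (pin) `inertia 𝔭 ⊓ S` fixes `W* = E[𝔮_ρ^∞]`; (frob) every arithmetic Frobenius lift
has an inertia-translate `F ∈ S` with `F − 1` onto `W*`; (B1) the Kummer cocycle on `inertia 𝔭 ⊓ S` lands in the kernel line. Here (pin) and
(frob) are DISCHARGED on the pinned frame from -w2 g8's local types (`CMPrimes.endEigenPrimaryTorsion_two_localTypes_named_of_pinned`: an
element of `Γ_{K_𝔭}` of Frobenius degree `n` acts on `W*[2^k]` as `χ_d·αⁿ`, `α² = α − 2` a unit), with `S :=` the stabiliser of the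
embedded `√d`:

* §1 `stabilizer_absClosureEmbedding_geomSqrt_eq` — `Stab_{Γ_K}(ι√d) = Stab_{Γ_K}(√(d : K))` (both are square roots of `d` in `K̄`); hence
  it is normal, open and of index `∣ 2` (Literature `WeierstrassCurve.stabilizer_geomSqrt_normal / isOpen_stabilizer_geomSqrt /
  index_stabilizer_geomSqrt`).
* §2 `smul_eq_self_of_mem_inertia_inf_stabilizer` — (pin): `τ ∈ inertia 𝔭` fixing `ι√d` acts trivially on `W*` (degree `0`, sign `+1`:
  scalar `≡ 1`).
* §3 `exists_sub_eq_of_isFrobPow_of_smul_eq` — a degree-one element fixing `ι√d` acts on `W*[2^k]` as `α`, and `α ≠ 1`, so `F − 1` is onto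
  the `2`-divisible `W*` (-w8 g3's `ReductionKernel.exists_sub_eq_of_scalar_ne_one`, divisibility from `CMPrimes.endEigenPrimaryTorsion_two_structure`);
  `exists_frob_translate_sub_surjective` — (frob), GIVEN one inertia element `i₀` negating `ι√d` (the ramified case: if the Frobenius lift
  negates `ι√d`, use `F := F₀·i₀`, of degree one by `IsFrobPow.mul_holds`).
* §4 `two_nsmul_resOfLe_proj_kummer_eq_zero_of_kernelLine` — **(ET-𝔭) ⟸ (B1) alone** on the pinned frame with a ramified `√d` at `𝔭`
  (`i₀`): the text of -w3 g10's `hET` for `(W.baseChange K, 𝔭, ρ, 1 − ρ)`.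

[cite: GreenbergLNM1716, §2 Props. 2.1–2.4, p. 70] [cite: Rubin1999, §3 Lemma 3.6 (ii), Thm. 3.15 (ii)] [cite: SerreLocalFields1979, XIII §1 Prop. 1]
[cite: TateCorvallis1979, §1.4 (1.4.1)]
-/

noncomputable section

set_option linter.dupNamespace false

open scoped Classical Pointwise

open CategoryTheory Function Field NumberField IsDedekindDomain WeierstrassCurve
open Literature.NumberTheory.EllipticCurves Literature.NumberTheory.EllipticCurves.GreenbergSelmer
open Literature.NumberTheory.EllipticCurves.ResKernel
open Literature.NumberTheory.GaloisRepresentations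
open Summit.BirchSwinnertonDyer.BirchSwinnertonDyer.Theorems.PrintCf2.RestrictedSelmerPair
open Summit.BirchSwinnertonDyer.BirchSwinnertonDyer.Theorems.PrintCf2.CMPrimes

universe u

namespace Summit.BirchSwinnertonDyer.BirchSwinnertonDyer.Theorems.PrintCf2.EtaleGeneration

variable {K : Type} [Field K] [NumberField K]

/-! ## §1. The stabiliser of the embedded `√d` -/

/-- `ι√d = ±√(d : K)` in `K̄`: both square to `d` (`ι = absClosureEmbedding ℚ K`). [folklore] -/
theorem absClosureEmbedding_geomSqrt_eq_or_eq_neg (d : ℚ) :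
    absClosureEmbedding ℚ K (WeierstrassCurve.geomSqrt d) = WeierstrassCurve.geomSqrt ((d : ℚ) : K) ∨
      absClosureEmbedding ℚ K (WeierstrassCurve.geomSqrt d) = -WeierstrassCurve.geomSqrt ((d : ℚ) : K) := by
  apply sq_eq_sq_iff_eq_or_eq_neg.mp
  rw [← map_pow, WeierstrassCurve.geomSqrt_sq, AlgHom.commutes, WeierstrassCurve.geomSqrt_sq, eq_ratCast, map_ratCast]

/-- **`Stab_{Γ_K}(ι√d) = Stab_{Γ_K}(√(d : K))`** (a Galois automorphism fixes `y` iff it fixes `−y`). [folklore] -/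
theorem stabilizer_absClosureEmbedding_geomSqrt_eq (d : ℚ) :
    MulAction.stabilizer (absoluteGaloisGroup K) (absClosureEmbedding ℚ K (WeierstrassCurve.geomSqrt d)) =
      MulAction.stabilizer (absoluteGaloisGroup K) (WeierstrassCurve.geomSqrt ((d : ℚ) : K)) := by
  rcases absClosureEmbedding_geomSqrt_eq_or_eq_neg (K := K) d with h | h
  · rw [h]
  · ext σ
    rw [MulAction.mem_stabilizer_iff, MulAction.mem_stabilizer_iff, h, smul_neg, neg_inj]

/-- `Stab_{Γ_K}(ι√d)` is normal. [folklore] -/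
theorem stabilizer_absClosureEmbedding_geomSqrt_normal (d : ℚ) :
    (MulAction.stabilizer (absoluteGaloisGroup K) (absClosureEmbedding ℚ K (WeierstrassCurve.geomSqrt d))).Normal := by
  rw [stabilizer_absClosureEmbedding_geomSqrt_eq]
  exact WeierstrassCurve.stabilizer_geomSqrt_normal _

/-- `Stab_{Γ_K}(ι√d)` is open. [folklore] -/
theorem isOpen_stabilizer_absClosureEmbedding_geomSqrt (d : ℚ) :
    IsOpen (MulAction.stabilizer (absoluteGaloisGroup K) (absClosureEmbedding ℚ K (WeierstrassCurve.geomSqrt d)) :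
      Set (absoluteGaloisGroup K)) := by
  rw [stabilizer_absClosureEmbedding_geomSqrt_eq]
  exact WeierstrassCurve.isOpen_stabilizer_geomSqrt _

/-- `[Γ_K : Stab_{Γ_K}(ι√d)] ∣ 2`. [folklore] -/
theorem index_stabilizer_absClosureEmbedding_geomSqrt_dvd (d : ℚ) :
    (MulAction.stabilizer (absoluteGaloisGroup K) (absClosureEmbedding ℚ K (WeierstrassCurve.geomSqrt d))).index ∣ 2 := by
  rw [stabilizer_absClosureEmbedding_geomSqrt_eq]
  rcases WeierstrassCurve.index_stabilizer_geomSqrt ((d : ℚ) : K) with h | h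
  · rw [h]; exact one_dvd _
  · rw [h]

/-! ## §2. (pin) `I_L` fixes `W*` on the pinned frame -/

section Frame

variable (W : WeierstrassCurve ℚ) [W.IsElliptic] (K)

/-- **(pin) `τ ∈ inertia 𝔭` fixing `ι√d` acts trivially on `W* = E[𝔮_ρ^∞]`** on the pinned frame (`j = −3375`, `θ² = −7` in `K`, `π² = π − 2`,
`ρ² = ρ − 2`, `C₁ • W = cm7^{(d)}`, `2 ∈ 𝔭` of residue degree one, inertia at `𝔭` acts on `W*` through `{±1}`): by -w2 g8's local types
`τ` (degree `0`, sign `+1`) acts on `W*[2^k]` as `N ≡ 1·α⁰ = 1`. [cite: Rubin1999, §3 Lemma 3.6 (ii)] [cite: GreenbergLNM1716, §2 p. 70] -/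
theorem smul_eq_self_of_mem_inertia_inf_stabilizer (hj : W.j = -3375) {θ : K} (hθ : θ ^ 2 = -7)
    (π : (W.baseChange K).endRing) (hrel : (π : AddMonoid.End (W.baseChange K).geomPoints) * π = π - 2)
    {ρ : ℤ_[2]} (hρ : ρ * ρ = ρ - 2) {d : ℚ} (hd : d ≠ 0) (C₁ : VariableChange ℚ) (hC₁ : C₁ • W = cm7.quadraticTwist d)
    (𝔭 : HeightOneSpectrum (𝓞 K)) (h𝔭 : ((2 : ℕ) : 𝓞 K) ∈ 𝔭.asIdeal) (hf : 𝔭.asIdeal.inertiaDeg (𝓞 ℚ) = 1)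
    (hclause : ∀ τ ∈ GreenbergSelmer.inertia 𝔭, ∀ x ∈ (W.baseChange K).endEigenPrimaryTorsion 2 π ρ, τ • x = x ∨ τ • x = -x) :
    ∀ τ ∈ GreenbergSelmer.inertia 𝔭 ⊓ MulAction.stabilizer (absoluteGaloisGroup K) (absClosureEmbedding ℚ K (WeierstrassCurve.geomSqrt d)),
      ∀ x : ↥((W.baseChange K).endEigenPrimaryTorsion 2 π ρ), τ • x = x := by
  intro τ hτ x
  haveI : Fact (Nat.Prime 2) := ⟨Nat.prime_two⟩
  obtain ⟨α, -, -, hloc⟩ := endEigenPrimaryTorsion_two_localTypes_named_of_pinned W K hj hθ π hrel hρ hd C₁ hC₁ 𝔭 h𝔭 hf hclause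
  obtain ⟨τ₀, hτ₀, hτ₀τ'⟩ := Subgroup.mem_map.mp hτ.1
  have hτ₀τ : absGaloisRestrict K (𝔭.adicCompletion K) τ₀ = τ := hτ₀τ'
  have hτ₀' : IsFrobPow τ₀ ((0 : ℕ) : ℤ) := by exact_mod_cast isFrobPow_zero_iff_mem_absInertia.mpr hτ₀
  have hfixd : absGaloisRestrict K (𝔭.adicCompletion K) τ₀ • absClosureEmbedding ℚ K (WeierstrassCurve.geomSqrt d) =
      absClosureEmbedding ℚ K (WeierstrassCurve.geomSqrt d) := by
    rw [hτ₀τ]; exact MulAction.mem_stabilizer_iff.mp hτ.2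
  obtain ⟨hW, -⟩ := hloc τ₀ 0 hτ₀' 1 (Or.inl ⟨hfixd, rfl⟩)
  obtain ⟨k, hk⟩ := AddCommGroup.mem_primaryComponent.mp (x : (W.baseChange K).geomPrimaryTorsion 2).2
  have hk' : 2 ^ k • (x : (W.baseChange K).geomPrimaryTorsion 2) = 0 :=
    Subtype.ext (by rw [AddSubmonoidClass.coe_nsmul, hk, ZeroMemClass.coe_zero])
  have h1 := hW k (x : (W.baseChange K).geomPrimaryTorsion 2) x.2 hk' 1
    (by rw [pow_zero, Units.val_one, Int.cast_one, one_mul, sub_self]; exact Ideal.zero_mem _)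
  rw [hτ₀τ, one_zsmul] at h1
  exact Subtype.ext h1

/-! ## §3. (frob) a Frobenius in `Γ_L` with `F − 1` onto `W*` -/

/-- **A degree-one element fixing `ι√d` has `F − 1` onto `W*`.** On the pinned frame, `σ ∈ Γ_{K_𝔭}` with `IsFrobPow σ 1` whose image
`F = absGaloisRestrict σ` fixes `ι√d` acts on `W*[2^k]` as `N ≡ α` (local types, sign `+1`), with `α² = α − 2`, so `α ≠ 1`; `W*` is
`2`-primary and `2`-divisible (`CMPrimes.endEigenPrimaryTorsion_two_structure`), hence `F − 1` maps `W*` ONTO `W*` (-w8 g3's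
`ReductionKernel.exists_sub_eq_of_scalar_ne_one`). [cite: GreenbergLNM1716, §2 Prop. 2.4 (p. 73)] [cite: SerreLocalFields1979, XIII §1 Prop. 1] -/
theorem exists_sub_eq_of_isFrobPow_of_smul_eq (hj : W.j = -3375) {θ : K} (hθ : θ ^ 2 = -7)
    (π : (W.baseChange K).endRing) (hrel : (π : AddMonoid.End (W.baseChange K).geomPoints) * π = π - 2)
    {ρ : ℤ_[2]} (hρ : ρ * ρ = ρ - 2) {d : ℚ} (hd : d ≠ 0) (C₁ : VariableChange ℚ) (hC₁ : C₁ • W = cm7.quadraticTwist d)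
    (𝔭 : HeightOneSpectrum (𝓞 K)) (h𝔭 : ((2 : ℕ) : 𝓞 K) ∈ 𝔭.asIdeal) (hf : 𝔭.asIdeal.inertiaDeg (𝓞 ℚ) = 1)
    (hclause : ∀ τ ∈ GreenbergSelmer.inertia 𝔭, ∀ x ∈ (W.baseChange K).endEigenPrimaryTorsion 2 π ρ, τ • x = x ∨ τ • x = -x)
    (σ : absoluteGaloisGroup (𝔭.adicCompletion K)) (hσ : IsFrobPow σ 1)
    (hfix : absGaloisRestrict K (𝔭.adicCompletion K) σ • absClosureEmbedding ℚ K (WeierstrassCurve.geomSqrt d) =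
      absClosureEmbedding ℚ K (WeierstrassCurve.geomSqrt d)) :
    ∀ m : ↥((W.baseChange K).endEigenPrimaryTorsion 2 π ρ), ∃ y : ↥((W.baseChange K).endEigenPrimaryTorsion 2 π ρ),
      absGaloisRestrict K (𝔭.adicCompletion K) σ • y - y = m := by
  intro m
  haveI : Fact (Nat.Prime 2) := ⟨Nat.prime_two⟩
  obtain ⟨α, hα, -, hloc⟩ := endEigenPrimaryTorsion_two_localTypes_named_of_pinned W K hj hθ π hrel hρ hd C₁ hC₁ 𝔭 h𝔭 hf hclause
  have hσ' : IsFrobPow σ ((1 : ℕ) : ℤ) := by exact_mod_cast hσ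
  obtain ⟨hW, -⟩ := hloc σ 1 hσ' 1 (Or.inl ⟨hfix, rfl⟩)
  -- `α ≠ 1`
  have hα1 : ((α : ℤ_[2]ˣ) : ℤ_[2]) ≠ 1 := by
    intro h1
    have h := hα
    rw [h1, one_pow] at h
    norm_num at h
  -- primary and divisible
  obtain ⟨-, -, -, -, hdiv, -⟩ := endEigenPrimaryTorsion_two_structure W hj K hθ π hrel hρ
  have hprim : ∀ y ∈ (W.baseChange K).endEigenPrimaryTorsion 2 π ρ, ∃ k : ℕ, 2 ^ k • y = 0 := fun y _ ↦ by
    obtain ⟨k, hk⟩ := AddCommGroup.mem_primaryComponent.mp y.2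
    exact ⟨k, Subtype.ext (by rw [AddSubmonoidClass.coe_nsmul, hk, ZeroMemClass.coe_zero])⟩
  -- the scalar clause for `F`
  set F := absGaloisRestrict K (𝔭.adicCompletion K) σ with hF
  have hscalar : ∀ (k : ℕ), ∀ x ∈ (W.baseChange K).endEigenPrimaryTorsion 2 π ρ, 2 ^ k • x = 0 →
      ∀ N : ℤ, ((N : ℤ_[2]) - (α : ℤ_[2])) ∈ (Ideal.span {(2 : ℤ_[2]) ^ k} : Ideal ℤ_[2]) →
        (DistribSMul.toAddMonoidHom ((W.baseChange K).geomPrimaryTorsion 2) F) x = N • x := fun k x hx hxk N hN ↦ by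
    rw [DistribSMul.toAddMonoidHom_apply]
    refine hW k x hx hxk N ?_
    rwa [pow_one, Int.cast_one, one_mul]
  obtain ⟨y, hy, hyy⟩ := ReductionKernel.exists_sub_eq_of_scalar_ne_one ((W.baseChange K).endEigenPrimaryTorsion 2 π ρ) hprim hdiv
    (DistribSMul.toAddMonoidHom ((W.baseChange K).geomPrimaryTorsion 2) F) hα1 hscalar (m : (W.baseChange K).geomPrimaryTorsion 2) m.2
  refine ⟨⟨y, hy⟩, Subtype.ext ?_⟩
  rw [DistribSMul.toAddMonoidHom_apply] at hyy
  exact hyy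

/-- **(frob) on the pinned frame, ramified case.** GIVEN one `i₀ ∈ inertia 𝔭` negating `ι√d` (i.e. `√d ∉ K_𝔭^{nr}`), every arithmetic Frobenius
lift `φ` has an inertia-translate `F ∈ Stab(ι√d)` (`F = F₀` or `F₀·i₀`, `F₀ = absGaloisRestrict φ`) with `F − 1` onto `W*` (§3 applied to `φ`
or to `φ·τ₁`, `τ₁ ↦ i₀`, of degree one by `IsFrobPow.mul_holds`). [cite: GreenbergLNM1716, §2 Prop. 2.4] [cite: TateCorvallis1979, §1.4 (1.4.1)] -/
theorem exists_frob_translate_sub_surjective (hj : W.j = -3375) {θ : K} (hθ : θ ^ 2 = -7)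
    (π : (W.baseChange K).endRing) (hrel : (π : AddMonoid.End (W.baseChange K).geomPoints) * π = π - 2)
    {ρ : ℤ_[2]} (hρ : ρ * ρ = ρ - 2) {d : ℚ} (hd : d ≠ 0) (C₁ : VariableChange ℚ) (hC₁ : C₁ • W = cm7.quadraticTwist d)
    (𝔭 : HeightOneSpectrum (𝓞 K)) (h𝔭 : ((2 : ℕ) : 𝓞 K) ∈ 𝔭.asIdeal) (hf : 𝔭.asIdeal.inertiaDeg (𝓞 ℚ) = 1)
    (hclause : ∀ τ ∈ GreenbergSelmer.inertia 𝔭, ∀ x ∈ (W.baseChange K).endEigenPrimaryTorsion 2 π ρ, τ • x = x ∨ τ • x = -x)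
    (hi₀ : ∃ i₀ ∈ GreenbergSelmer.inertia 𝔭, i₀ • absClosureEmbedding ℚ K (WeierstrassCurve.geomSqrt d) =
      -absClosureEmbedding ℚ K (WeierstrassCurve.geomSqrt d)) :
    ∀ φ : absoluteGaloisGroup (𝔭.adicCompletion K), IsFrobPow φ 1 →
      ∃ F ∈ MulAction.stabilizer (absoluteGaloisGroup K) (absClosureEmbedding ℚ K (WeierstrassCurve.geomSqrt d)),
        (absGaloisRestrict K (𝔭.adicCompletion K) φ)⁻¹ * F ∈ GreenbergSelmer.inertia 𝔭 ∧
        ∀ m : ↥((W.baseChange K).endEigenPrimaryTorsion 2 π ρ), ∃ y : ↥((W.baseChange K).endEigenPrimaryTorsion 2 π ρ), F • y - y = m := by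
  intro φ hφ
  rcases smul_absClosureEmbedding_geomSqrt_eq_or K d (absGaloisRestrict K (𝔭.adicCompletion K) φ) with hplus | hminus
  · refine ⟨absGaloisRestrict K (𝔭.adicCompletion K) φ, MulAction.mem_stabilizer_iff.mpr hplus, ?_, ?_⟩
    · rw [inv_mul_cancel]; exact one_mem _
    · exact exists_sub_eq_of_isFrobPow_of_smul_eq K W hj hθ π hrel hρ hd C₁ hC₁ 𝔭 h𝔭 hf hclause φ hφ hplus
  · obtain ⟨i₀, hi₀I, hi₀d⟩ := hi₀
    obtain ⟨τ₁, hτ₁, hτ₁i'⟩ := Subgroup.mem_map.mp hi₀I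
    have hτ₁i : absGaloisRestrict K (𝔭.adicCompletion K) τ₁ = i₀ := hτ₁i'
    have hdeg : IsFrobPow (φ * τ₁) 1 := by
      have h := IsFrobPow.mul_holds hφ (isFrobPow_zero_iff_mem_absInertia.mpr hτ₁)
      rwa [add_zero] at h
    have hFfix : absGaloisRestrict K (𝔭.adicCompletion K) (φ * τ₁) • absClosureEmbedding ℚ K (WeierstrassCurve.geomSqrt d) =
        absClosureEmbedding ℚ K (WeierstrassCurve.geomSqrt d) := by
      rw [map_mul, mul_smul, hτ₁i, hi₀d, smul_neg, hminus, neg_neg]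
    refine ⟨absGaloisRestrict K (𝔭.adicCompletion K) (φ * τ₁), MulAction.mem_stabilizer_iff.mpr hFfix, ?_, ?_⟩
    · rw [map_mul, inv_mul_cancel_left, hτ₁i]; exact hi₀I
    · exact exists_sub_eq_of_isFrobPow_of_smul_eq K W hj hθ π hrel hρ hd C₁ hC₁ 𝔭 h𝔭 hf hclause (φ * τ₁) hdeg hFfix

/-! ## §4. (ET-𝔭) from (B1) alone, on the pinned frame with `√d` ramified at `𝔭` -/

/-- **(ET-𝔭) ⟸ (B1).** On the pinned frame (`j = −3375`, `θ² = −7` in `K`, `π² = π − 2`, `ρ² = ρ − 2`, `C₁ • W = cm7^{(d)}`, `2 ∈ 𝔭` of residue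
degree one, inertia at `𝔭` acts on `W* = E[𝔮_ρ^∞]` through `{±1}`), with ONE inertia element negating `ι√d`, the étale brick
«`2 • res_{⊤ ⊓ D_𝔭}(e_* res_⊤ κ_n(Q)) = 0` for every equivariant projector `e` onto `W*` killing `E[𝔮_{1−ρ}^∞]`, every `Q ∈ E(K)`, every `n`»
follows from the SINGLE arithmetic input (B1): «for every such `e`, every `Q`, `n`, every `2^n`-th root `R` of `Q` and every `i ∈ inertia 𝔭`
fixing `ι√d`: `e(iR − R) = 0`» (Greenberg: over `L_𝔭 = K_𝔭(√d)` the curve has good reduction and `iR − R` lies in the kernel-of-reduction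
line `E[𝔮_{1−ρ}^∞]`). Assembly: p687144 §5 with `S := Stab(ι√d)` (§1) and the inputs (pin), (frob) of §§2–3.
[cite: GreenbergLNM1716, §2 Props. 2.1–2.4 (pp. 62–63, 70–75)] [cite: Rubin1999, §3 Lemma 3.6 (ii)] [cite: SerreGaloisCohomology1997, I.§2.4 Prop. 9] -/
theorem two_nsmul_resOfLe_proj_kummer_eq_zero_of_kernelLine (hj : W.j = -3375) {θ : K} (hθ : θ ^ 2 = -7)
    (π : (W.baseChange K).endRing) (hrel : (π : AddMonoid.End (W.baseChange K).geomPoints) * π = π - 2)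
    {ρ : ℤ_[2]} (hρ : ρ * ρ = ρ - 2) {d : ℚ} (hd : d ≠ 0) (C₁ : VariableChange ℚ) (hC₁ : C₁ • W = cm7.quadraticTwist d)
    (𝔭 : HeightOneSpectrum (𝓞 K)) (h𝔭 : ((2 : ℕ) : 𝓞 K) ∈ 𝔭.asIdeal) (hf : 𝔭.asIdeal.inertiaDeg (𝓞 ℚ) = 1)
    (hclause : ∀ τ ∈ GreenbergSelmer.inertia 𝔭, ∀ x ∈ (W.baseChange K).endEigenPrimaryTorsion 2 π ρ, τ • x = x ∨ τ • x = -x)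
    (hi₀ : ∃ i₀ ∈ GreenbergSelmer.inertia 𝔭, i₀ • absClosureEmbedding ℚ K (WeierstrassCurve.geomSqrt d) =
      -absClosureEmbedding ℚ K (WeierstrassCurve.geomSqrt d))
    (hB1 : ∀ (e : (W.baseChange K).geomPrimaryTorsion 2 →+ ↥((W.baseChange K).endEigenPrimaryTorsion 2 π ρ))
        (_ : ∀ x : ↥((W.baseChange K).endEigenPrimaryTorsion 2 π ρ), e x = x)
        (_ : ∀ x ∈ (W.baseChange K).endEigenPrimaryTorsion 2 π (1 - ρ), e x = 0)
        (_ : ∀ (σ : absoluteGaloisGroup K) (x : (W.baseChange K).geomPrimaryTorsion 2), e (σ • x) = σ • e x)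
        (Q : (W.baseChange K).toAffine.Point) (n : ℕ) (R : (W.baseChange K).geomPoints), 2 ^ n • R = toGeomPoints (W.baseChange K) Q →
        ∀ i ∈ GreenbergSelmer.inertia 𝔭 ⊓ MulAction.stabilizer (absoluteGaloisGroup K) (absClosureEmbedding ℚ K (WeierstrassCurve.geomSqrt d)),
          ∀ m : (W.baseChange K).geomPrimaryTorsion 2, (m : (W.baseChange K).geomPoints) = i • R - R → e m = 0) :
    ∀ (e : (W.baseChange K).geomPrimaryTorsion 2 →+ ↥((W.baseChange K).endEigenPrimaryTorsion 2 π ρ))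
        (he₁ : ∀ x : ↥((W.baseChange K).endEigenPrimaryTorsion 2 π ρ), e x = x)
        (he0 : ∀ x ∈ (W.baseChange K).endEigenPrimaryTorsion 2 π (1 - ρ), e x = 0)
        (he : ∀ (σ : absoluteGaloisGroup K) (x : (W.baseChange K).geomPrimaryTorsion 2), e (σ • x) = σ • e x)
        (Q : (W.baseChange K).toAffine.Point) (n : ℕ),
        2 • resOfLe ↥((W.baseChange K).endEigenPrimaryTorsion 2 π ρ) (inf_le_left : ⊤ ⊓ decomp 𝔭 ≤ ⊤)
          (resH1Hom (ContinuousMonoidHom.id (⊤ : Subgroup (absoluteGaloisGroup K))) e (fun σ x ↦ he σ x)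
            (resSubgroup ⊤ ((W.baseChange K).geomPrimaryTorsion 2)
              ((W.baseChange K).kummerMapLevel 2 (W.baseChange K).zsmul_geomPoints_surjective_holds n Q))) = 0 := by
  haveI : (W.baseChange K).IsElliptic := by rw [baseChange]; infer_instance
  haveI := stabilizer_absClosureEmbedding_geomSqrt_normal (K := K) d
  exact two_nsmul_resOfLe_proj_kummer_eq_zero_of_inputs (W.baseChange K) 𝔭 π ρ (1 - ρ)
    (MulAction.stabilizer (absoluteGaloisGroup K) (absClosureEmbedding ℚ K (WeierstrassCurve.geomSqrt d)))
    (isOpen_stabilizer_absClosureEmbedding_geomSqrt d) (index_stabilizer_absClosureEmbedding_geomSqrt_dvd d)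
    (smul_eq_self_of_mem_inertia_inf_stabilizer K W hj hθ π hrel hρ hd C₁ hC₁ 𝔭 h𝔭 hf hclause)
    (exists_frob_translate_sub_surjective K W hj hθ π hrel hρ hd C₁ hC₁ 𝔭 h𝔭 hf hclause hi₀) hB1

end Frame

end Summit.BirchSwinnertonDyer.BirchSwinnertonDyer.Theorems.PrintCf2.EtaleGeneration

end
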